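import Summits.PneNP.PneNP.Theorems.ChebyshevTracialDesignHSymmetricAmplitudeOne
import Summits.PneNP.PneNP.Theorems.ChebyshevTracialDesignErrorScales
import HarnessLib

/-!
# Cell pnp-psdrank, route `ChebyshevTracialDesign`: the 𝒜₁ rung with `H`-symmetric amplitudes AT THE CRUX'S SCALE `e^{−a·dq n}` — brick 146c
# (crux `TracialDecayExp20`, stmt-PneNP-19878)

Brick 146c (prover g29; MEMO-32 §6). Brick 146 (`…HSymmetricAmplitudeOne.hSymmetric_amplitudeOne_value_le`) bounds the design value of the psd strategies
`X_U = ψ(|U∩H|)·B_UB_Uᵀ` (`deg B = 1`, `B_UB_Uᵀ ⪯ I`) against every psd contraction field by `6·10⁷·G·n⁶·(e^{−a·dq n} + 2^{−⌊n/40⌋} + √P_{dq n−4})·r`; brick 146b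
(`…ErrorScales`) shows both auxiliary scales are eventually `≤ e^{−a·dq n}`. Hence:
* **`hSymmetric_amplitudeOne_value_le_exp`**: `Σ_{U,M} W(U,M)·ψ(|U∩H|)·tr(B_UB_UᵀY_M) ≤ 2·10⁸·G·n⁶·e^{−a·dq n}·r` for all large even `n` — the crux's
  currency exactly (design weight of `TracialDecayExp20`, value linear in the dimension `r`, rate `e^{−a·dq n}` times `poly(n)`), for this strategy class.
WHAT THIS FILE DOES NOT DO: other classes; anything on `TracialDecayExp20` itself beyond this class, psd rank of P_PM(K_n), or P vs NP.
[cite: GriblingDelaatLaurent2019, §5] [cite: Rothvoss2017, §2 and Lemma 7 (PDF pp. 5–8)] [cite: KeevashLifshitz2023, Thm. 1.8]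
Stature: support/instrument (kernel lane, no defs, axioms standard) — rung-type statement for a named strategy class. Supports stmt-PneNP-19878.
-/

set_option linter.dupNamespace false -- `Summit.PneNP.PneNP.…`: summit = sub-problem (D-0017)

noncomputable section

namespace Summit.PneNP.PneNP.Theorems.ChebyshevTracialDesignHSymmetricAmplitudeOneExp

open Finset Matrix Literature.Barriers.PneNP Literature.Combinatorics.Optimization
open Summit.PneNP.PneNP.Theorems.ChebyshevTracialDesignHSymmetricAmplitudeOne (hSymmetric_amplitudeOne_value_le)
open Summit.PneNP.PneNP.Theorems.ChebyshevTracialDesignErrorScales (half_pow_le_exp_dq sqrt_attenuation_le_exp_dq)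

variable {n : ℕ}

/-- **The 𝒜₁ rung with `H`-symmetric amplitudes at the crux's scale**: as `hSymmetric_amplitudeOne_value_le`, with the bound
`2·10⁸·G·n⁶·e^{−a·dq n}·r` (the aligned tail `2^{−⌊n/40⌋}` and the attenuation `√P_{dq n−4}` are eventually below `e^{−a·dq n}`, brick 146b).
[cite: GriblingDelaatLaurent2019, §5] [cite: Rothvoss2017, §2 and Lemma 7 (PDF pp. 5–8)] [cite: KeevashLifshitz2023, Thm. 1.8] -/
theorem hSymmetric_amplitudeOne_value_le_exp :
    ∃ a : ℝ, 0 < a ∧ ∃ n₀ : ℕ, ∀ n : ℕ, n₀ ≤ n → Even n → ∀ {t : ℕ} {C : Finset ℕ} {w : ℕ → ℝ},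
    IsBalancedDesign n t (Tq n) (dq n) 20 C w →
    ∀ (H : Finset (Fin n)), 2 * H.card = n →
    ∀ (ψ : ℤ → ℝ) {G : ℝ}, 0 ≤ G → (∀ x, 0 ≤ ψ x) → (∀ x, ψ x ≤ G) →
    ∀ {r m : ℕ} (β : Fin n → Matrix (Fin r) (Fin m) ℝ),
    (∀ U : OddSet n, U.1.card = t →
      (1 - (∑ p, (if p ∈ U.1 then (1 : ℝ) else 0) • β p) * (∑ p, (if p ∈ U.1 then (1 : ℝ) else 0) • β p)ᵀ).PosSemidef) →
    ∀ (Y : PMatch n → Matrix (Fin r) (Fin r) ℝ), (∀ M, (Y M).PosSemidef ∧ (1 - Y M).PosSemidef) →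
    ∑ U : OddSet n, ∑ M : PMatch n, levelWeight n t C w U M *
        (ψ ((U.1 ∩ H).card : ℤ) *
          ((∑ p, (if p ∈ U.1 then (1 : ℝ) else 0) • β p) * (∑ p, (if p ∈ U.1 then (1 : ℝ) else 0) • β p)ᵀ * Y M).trace) ≤
      2 * 10 ^ 8 * G * (n : ℝ) ^ 6 * Real.exp (-(a * dq n)) * r := by
  obtain ⟨a, ha, n₁, h⟩ := hSymmetric_amplitudeOne_value_le
  obtain ⟨n₂, h2⟩ := half_pow_le_exp_dq ha
  obtain ⟨n₃, h3⟩ := sqrt_attenuation_le_exp_dq ha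
  refine ⟨a, ha, max n₁ (max n₂ n₃), ?_⟩
  intro n hn hev t C w hdes H hH ψ G hG0 hψ0 hψG r m β hB Y hY
  have k1 := h n (le_trans (le_max_left _ _) hn) hev hdes H hH ψ hG0 hψ0 hψG β hB Y hY
  have k2 := h2 n (le_trans (le_trans (le_max_left _ _) (le_max_right _ _)) hn)
  have k3 := h3 n (le_trans (le_trans (le_max_right _ _) (le_max_right _ _)) hn)
  refine k1.trans ?_
  have hG6 : 0 ≤ G * (n : ℝ) ^ 6 * (r : ℝ) := by positivity
  nlinarith [k2, k3, hG6, Real.exp_pos (-(a * dq n))]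

end Summit.PneNP.PneNP.Theorems.ChebyshevTracialDesignHSymmetricAmplitudeOneExp

end
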